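import Literature.AlgebraicGeometry.HodgeTheory.FermatFourfoldSemiDecomposableEigenlines
import Literature.AlgebraicGeometry.HodgeTheory.FermatJuxtapositionGysin
import Literature.AlgebraicGeometry.HodgeTheory.LefschetzOneOne
import HarnessLib

/-!
# The semi-decomposable eigenlines of the Fermat fourfold (proof file of `Shioda1979_claim_semiDecomposable`): reduction to the ruled-join span, Lefschetz `(1,1)` on `X¹ₘ × X¹ₘ` and `dim V(α) ≤ 1`

Family `hodge`, layer `Literature/AlgebraicGeometry/HodgeTheory`. PROOF FILE (D-0026: everything here
is PROVED; no named fact and no definition is introduced) for the named fact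
`Shioda1979_claim_semiDecomposable` of `FermatFourfoldSemiDecomposableEigenlines` — Shioda, Proc.
Japan Acad. 55A (1979) §1 Definition (iii) and §4; Ran, Compositio Math. 42 (1980) §4: for two
characters `β, γ ∈ 𝔄¹ₘ` of the Fermat CURVE (three non-zero coordinates, sum `0`) and any Hodge
character `α ∼ β ∗ γ` of the Fermat FOURFOLD `X⁴ₘ`, claim(`α`): `V(α) ⊆ H⁴(X⁴ₘ(ℂ); ℂ)` consists of
classes of codimension-`2` algebraic cycles.

The printed proof (texts read: Shioda PJA p. 113–114; Ran pp. 138–140), and where each step lives: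

* (R) **Ran's ruled join** (§4, pp. 138–139): `V′ = X¹ₘ ⊂ P′ = {x₃ = x₄ = x₅ = 0}`,
  `V″ = X¹ₘ ⊂ P″ = {x₀ = x₁ = x₂ = 0}`, "if `p′ ∈ V′` and `p″ ∈ V″` then the line `p′p″` … is
  entirely contained in `V`"; `I₀ → V′ × V″` the `ℙ¹`-bundle of these lines, `p₂ : I₀ → V = X⁴ₘ`,
  `∗ = p₂₊ p₁^* K` (`K` the Künneth map), and "It is obvious by construction that if `c′` and `c″`
  are algebraic then so is `c′ ∗ c″`" — more generally `p₂₊ p₁^*` carries algebraic classes of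
  `V′ × V″` to algebraic classes of `V`. On the tree's real carriers this transport is PROVED for any
  span `Y ←π— E —φ→ X` of smooth projective varieties with `π` flat
  (`complexGysin_map_mem_algebraicClasses_of_flat` of `FermatJuxtapositionGysin`: flat pull-back and
  the support form of the proper push-forward `complexGysin μ`); the span `I₀` itself (a
  multi-projective incidence variety) is NOT in the tree and enters below as data
  `X¹ₘ ⊗ X¹ₘ ←π— E —φ→ X⁴ₘ`, `dim E = 3`.
* (E) **Equivariance / injectivity** (Ran (4.3), Prop. 4.6, Cor. 4.7 "`H_{χ′} ∗ H_{χ″} = H_{χ′∗χ″}`";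
  Shioda §4: the map `(∗)` "is equivariant with respect to the natural action of `G`" and an
  isomorphism onto `Hⁿ_prim`): the `(β∗γ)`-eigenline of `X⁴ₘ` is the `∗`-image of the
  `(β, γ)`-isotypic line `V(β) ⊗ V(γ) ⊂ H²(X¹ₘ × X¹ₘ)`. NOT in the tree; it enters either as
  "`V(β∗γ) ⊆ span φ_*π^*(…)`" (Shioda's road, `…_of_typeII`, `…_of_lefschetzOneOne`) or as "some
  `φ_*π^* K` has non-zero `(β∗γ)`-component" together with `dim V(β∗γ) ≤ 1` (Ran's / Aoki's road
  "represents ⟹ claim", `…_of_join`; `dim V(α) = 1` is Ran Prop. 1.7 (i), Shioda §4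
  "`dim V(α) = 1`", the hypothesis `hE1` shared by every assembly of this layer).
* (L) **Lefschetz on `X¹ₘ × X¹ₘ`** (Shioda §4: "construct algebraic cycles on `Xⁿₘ` from those on
  … `X^{r-1}ₘ × X^{s-1}ₘ` where the Hodge Conjecture … is known … by Lefschetz theorem"; Ran uses
  the same theorem in Thm. 3.16): the rational sub-Hodge structure `⨁ₜ V(tβ) ⊗ V(tγ)` of
  `H²(X¹ₘ × X¹ₘ)` is of type `(1,1)` exactly when `β∗γ` is a Hodge character (Ran Prop. 1.7
  (ii)–(iii)), hence spanned by divisor classes. The tree's named fact `lefschetzOneOne_rational`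
  (file `LefschetzOneOne`, NOT proved) is threaded as the hypothesis `hL`; the Hodge types of the
  curve eigenlines are NOT in the tree and stay inside the hypotheses as "rational classes of type
  `(1,1)`".
* (P) **Permutations**: the fact quantifies over every `α` with the multiset of values of `β` plus
  that of `γ`; the geometric input is only needed for the LITERAL juxtaposition
  `(β₀, β₁, β₂, γ₀, γ₁, γ₂)` (Ran's placement of `P′`, `P″`), claim being invariant under the
  symmetric group (`FermatCharacter.Claim.of_univ_val_map_eq`, PROVED in
  `FermatClaimPermutationInvariance`) — `univ_val_map_appendCurve` below.

Assemblies PROVED here: `Shioda1979_claim_semiDecomposable_of_typeII` ((R)+(E) in span form),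
`Shioda1979_claim_semiDecomposable_of_lefschetzOneOne` (the same with (L) explicit: `hL` and rational
`(1,1)`-classes on `X¹ₘ ⊗ X¹ₘ`), `Shioda1979_claim_semiDecomposable_of_join` ((R) + a representing
class + `hE1`). Hence the residual obligations of `Shioda1979_claim_semiDecomposable_holds` are
exactly: the span `I₀` as a smooth projective `ℂ`-scheme with `π` flat, its equivariance (E) on the
tree's carriers, the Hodge types of the curve eigenlines, and `lefschetzOneOne_rational`.

Arithmetic PROVED here (the character-level shadow of (L), Ran Prop. 1.7 (ii)–(iii); Shioda §1
Definition (iii) "this occurs only if `y = 3`"): `FermatCharacter.isHodge_appendCurve_iff` —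
`β ∗ γ ∈ 𝔅⁴ₘ` iff `|tβ| + |tγ| = 3` for every unit `t`; `FermatCharacter.normSum_eq_or_of_curve` —
`|δ| ∈ {1, 2}` on `𝔄¹ₘ`; hence `FermatCharacter.isHodge_appendCurve_iff_normSum_eq` — `β ∗ γ ∈ 𝔅⁴ₘ`
iff `{|tβ|, |tγ|} = {1, 2}` for every unit `t` (each `V(tβ) ⊗ V(tγ)` of type `(1,1)`), and
`FermatCharacter.normSum_unitMul_eq_normSum_unitMul_neg_of_isHodge_appendCurve` — then `γ` and
`−β` have the same CM type `t ↦ |t·|`.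

Remark (enumeration, not formalized; recorded with the unit's notes). A semi-decomposable Hodge
multiset containing a pair `{a, −a}` is decomposable (`IsHodgeMultiset.isDecomposable_of_pair`),
and for every `m ≤ 35` every semi-decomposable Hodge sextuple is decomposable or quasi-decomposable
in the sense of `FermatShiodaCondition` (so for the degrees whose `ShiodaCondition` is certified in
the tree the clause is covered by the surface and type-I inputs); this fails first for
`m = 36, 39, 54, 60` — e.g. `β = (1, 16, 22)`, `γ = (7, 34, 37) = 7β` modulo `39` (`16³ ≡ 1`), whose
juxtaposition is an indecomposable, not quasi-decomposable Hodge character of `X⁴₃₉` — where the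
curve × curve construction of this fact is the only printed road.

## References

* [Shioda1979PJA] T. Shioda, The Hodge conjecture and the Tate conjecture for Fermat varieties,
  Proc. Japan Acad. 55A (1979) 111–114: §1 Definition (iii) (p. 111–112), §4 (pp. 113–114: the map
  `(∗)`, "`dim V(α) = 1`", "preserves algebraic cycles", "by Lefschetz theorem") (text read,
  doi:10.3792/pjaa.55.111).
* [Ran1980] Z. Ran, Cycles on Fermat hypersurfaces, Compositio Math. 42 (1980) 121–142: §4
  pp. 138–139 (ruled join, `∗ = p₂₊ p₁^* K`, "if `c′` and `c″` are algebraic then so is `c′ ∗ c″`"),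
  (4.3), Prop. 4.6, Cor. 4.7 (p. 140), Prop. 1.7 (p. 125) (text read, numdam CM_1980__42_1_121_0).
* [VoisinHodgeI2002] C. Voisin, Hodge Theory and Complex Algebraic Geometry I, Thm. 11.30
  (Lefschetz theorem on `(1,1)`-classes).
* [Aoki1987] N. Aoki, Some new algebraic cycles on Fermat varieties, J. Math. Soc. Japan 39 (1987),
  p. 386 ("represents ⟹ claim").
* [FultonYoungTableaux1997] W. Fulton, Young Tableaux, App. B §B.2 Ex. 5 (push-forward and supports).
-/

noncomputable section

open CategoryTheory AlgebraicGeometry MonoidalCategory Finset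
open Literature.AlgebraicTopology.SingularHomology

namespace Literature.AlgebraicGeometry.HodgeTheory

open Literature.AlgebraicGeometry.Motives

namespace FermatCharacter

variable {m : ℕ}

/-! ### The literal juxtaposition of two curve characters -/

/-- The Fermat fourfold has as many coordinates as two Fermat curves. [folklore] -/
theorem two_mul_two_add_two : 2 * 2 + 2 = 3 + 3 := rfl

/-- The multiset of values of the literal juxtaposition `β ∗ γ = (β₀, β₁, β₂, γ₀, γ₁, γ₂)` of two
curve characters (a character of `X⁴ₘ`, `Fin.append` through the cast `Fin (2·2+2) ≃ Fin (3+3)`)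
is that of `β` plus that of `γ`. [cite: Ran1980, §1 p. 125 (juxtaposition `χ′ ∗ χ″`)] -/
theorem univ_val_map_appendCurve (β γ : Fin 3 → ZMod m) :
    univ.val.map (Fin.append β γ ∘ finCongr two_mul_two_add_two) = univ.val.map β + univ.val.map γ := by
  rw [← Multiset.map_map, Multiset.map_univ_val_equiv, Fin.univ_val_map, Fin.univ_val_map,
    Fin.univ_val_map, List.ofFn_fin_append, Multiset.coe_add]

/-- A Hodge character `α ∼ β ∗ γ` makes the literal juxtaposition a Hodge character (it is a
permutation of `α`). [cite: Shioda1979PJA, §1] -/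
theorem isHodge_appendCurve_of_univ_val_map_eq [NeZero m] {β γ : Fin 3 → ZMod m}
    {α : Fin (2 * 2 + 2) → ZMod m} (hα : IsHodge α)
    (hαs : univ.val.map α = univ.val.map β + univ.val.map γ) :
    IsHodge (Fin.append β γ ∘ finCongr two_mul_two_add_two) := by
  classical
  obtain ⟨σ, hσ⟩ := exists_perm_eq_comp_of_univ_val_map_eq
    (hαs.trans (univ_val_map_appendCurve β γ).symm)
  rw [hσ]
  exact hα.compEquiv σ

end FermatCharacter

/-! ### Shioda's road: `V(β∗γ)` inside the `φ_*π^*`-image of the algebraic classes of `X¹ₘ × X¹ₘ` -/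

/-- **`Shioda1979_claim_semiDecomposable` from a type-II span whose push–pull image of the divisor
classes of `X¹ₘ × X¹ₘ` spans `V(β∗γ)`** (Shioda §4: by the map `(∗)`, "equivariant … and which
preserves algebraic cycles", "we can construct algebraic cycles on `Xⁿ` from those on …
`X^{r-1} × X^{s-1}`"; Ran §4: `∗ = p₂₊ p₁^*` through the `ℙ¹`-bundle `I₀ → V′ × V″` of joining
lines, Cor. 4.7 `H_{χ′} ∗ H_{χ″} = H_{χ′∗χ″}`). Granted, for all curve characters `β, γ ∈ 𝔄¹ₘ` whose
literal juxtaposition is a Hodge character, a span `X¹ₘ ⊗ X¹ₘ ←π— E —φ→ X⁴ₘ` of smooth projective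
varieties (`dim E = 3`, `π` flat; intended: `E = I₀`) such that the eigenline `V(β∗γ)` lies in the
span of the classes `φ_*(π^* K)`, `K ∈ N¹H²(X¹ₘ × X¹ₘ)` a divisor class — the conjunction of (E)
"`V(β∗γ) = V(β) ∗ V(γ)`" and (L) "`V(β) ⊗ V(γ)` lies in the span of divisor classes" of the module
docstring — the fact follows: `φ_*π^*` carries `N¹H²(X¹ₘ × X¹ₘ)` into `N²H⁴(X⁴ₘ)`
(`complexGysin_map_mem_algebraicClasses_of_flat`), and claim is invariant under permutations of the
coordinates (`FermatCharacter.Claim.of_univ_val_map_eq`).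
[cite: Shioda1979PJA, §4 (pp. 113–114)] [cite: Ran1980, §4 pp. 138–140, Cor. 4.7]
[cite: FultonYoungTableaux1997, Appendix B §B.2 Exercise 5] -/
theorem Shioda1979_claim_semiDecomposable_of_typeII
    (htypeII : ∀ (m : ℕ) [NeZero m] (β γ : Fin 3 → ZMod m),
      (∀ i, β i ≠ 0) → (∀ i, γ i ≠ 0) → ∑ i, β i = 0 → ∑ i, γ i = 0 →
      FermatCharacter.IsHodge (Fin.append β γ ∘ finCongr FermatCharacter.two_mul_two_add_two) →
      ∃ (μ : OrientationFamily) (e : ℕ) (E : Motives.SchemeOver ℂ) (hE : IsSmoothProjective e E)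
        (hX : IsSmoothProjective (2 * 2) (fermatHypersurface (2 * 2) m))
        (π : E ⟶ fermatHypersurface 1 m ⊗ fermatHypersurface 1 m) (_ : Flat π.left)
        (φ : E ⟶ fermatHypersurface (2 * 2) m) (he : e = 3),
        fermatEigenspace m (Fin.append β γ ∘ finCongr FermatCharacter.two_mul_two_add_two) (2 * 2) ≤
          Submodule.span ℂ
            ((fun K ↦ complexGysin μ hE hX φ (show 2 * 1 + 2 * (2 * 2) = 2 * 2 + 2 * e by omega)
                (complexBetti.map π (2 * 1) K)) ''
              (algebraicClasses (fermatHypersurface 1 m ⊗ fermatHypersurface 1 m) 1 :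
                Set (complexBetti (fermatHypersurface 1 m ⊗ fermatHypersurface 1 m) (2 * 1))))) :
    Shioda1979_claim_semiDecomposable := by
  intro m _ β γ α hβ0 hγ0 hβ hγ hα hαs
  have hH := FermatCharacter.isHodge_appendCurve_of_univ_val_map_eq hα hαs
  refine FermatCharacter.Claim.of_univ_val_map_eq
    (hαs.trans (FermatCharacter.univ_val_map_appendCurve β γ).symm) ?_
  obtain ⟨μ, e, E, hE, hX, π, hπ, φ, he, hV⟩ := htypeII m β γ hβ0 hγ0 hβ hγ hH
  haveI := hπ
  have hC : IsSmoothProjective 1 (fermatHypersurface 1 m) :=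
    isSmoothProjective_fermatHypersurface le_rfl NeZero.one_le
  intro x hx
  refine (Submodule.span_le.mpr ?_) (hV hx)
  rintro _ ⟨K, hK, rfl⟩
  exact complexGysin_map_mem_algebraicClasses_of_flat μ hE (IsSmoothProjective.tensor_holds hC hC)
    hX π φ (by omega) hK

/-- **`Shioda1979_claim_semiDecomposable` from Lefschetz `(1,1)` on `X¹ₘ × X¹ₘ` and a type-II span**
— the printed architecture with the Lefschetz theorem explicit (Shioda §4: "… from those on
`X^{r-1}ₘ × X^{s-1}ₘ` where the Hodge Conjecture … is known … by Lefschetz theorem"). Granted the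
tree's named fact `lefschetzOneOne_rational` (Voisin I, Thm. 11.30; hypothesis `hL`) and, for all
curve characters `β, γ ∈ 𝔄¹ₘ` with `β∗γ` Hodge, a span `X¹ₘ ⊗ X¹ₘ ←π— E —φ→ X⁴ₘ` (`dim E = 3`,
`π` flat) such that `V(β∗γ)` lies in the span of the `φ_*(π^* K)`, `K` a RATIONAL class of Hodge
type `(1,1)` on the product surface (Ran Prop. 1.7 (ii)–(iii): `⨁ₜ V(tβ) ⊗ V(tγ)` is defined over
`ℚ` and of type `(1,1)` iff `β∗γ ∈ 𝔅⁴ₘ`; with (E) `V(β∗γ) = V(β) ∗ V(γ)`), the fact follows: such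
`K` are divisor classes by `hL` for the smooth projective surface `X¹ₘ ⊗ X¹ₘ`
(`IsSmoothProjective.tensor_holds`), and `Shioda1979_claim_semiDecomposable_of_typeII` applies.
[cite: Shioda1979PJA, §4 (p. 114)] [cite: VoisinHodgeI2002, Thm. 11.30]
[cite: Ran1980, Prop. 1.7 (ii)–(iii) and Cor. 4.7] -/
theorem Shioda1979_claim_semiDecomposable_of_lefschetzOneOne (hL : lefschetzOneOne_rational)
    (htypeII : ∀ (m : ℕ) [NeZero m] (β γ : Fin 3 → ZMod m),
      (∀ i, β i ≠ 0) → (∀ i, γ i ≠ 0) → ∑ i, β i = 0 → ∑ i, γ i = 0 →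
      FermatCharacter.IsHodge (Fin.append β γ ∘ finCongr FermatCharacter.two_mul_two_add_two) →
      ∃ (μ : OrientationFamily) (e : ℕ) (E : Motives.SchemeOver ℂ) (hE : IsSmoothProjective e E)
        (hX : IsSmoothProjective (2 * 2) (fermatHypersurface (2 * 2) m))
        (π : E ⟶ fermatHypersurface 1 m ⊗ fermatHypersurface 1 m) (_ : Flat π.left)
        (φ : E ⟶ fermatHypersurface (2 * 2) m) (he : e = 3),
        fermatEigenspace m (Fin.append β γ ∘ finCongr FermatCharacter.two_mul_two_add_two) (2 * 2) ≤
          Submodule.span ℂ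
            ((fun K ↦ complexGysin μ hE hX φ (show 2 * 1 + 2 * (2 * 2) = 2 * 2 + 2 * e by omega)
                (complexBetti.map π (2 * 1) K)) ''
              {K : complexBetti (fermatHypersurface 1 m ⊗ fermatHypersurface 1 m) (2 * 1) |
                IsRationalClass K ∧
                  IsOfHodgeType (1 + 1) (fermatHypersurface 1 m ⊗ fermatHypersurface 1 m) (2 * 1) 1 1 K})) :
    Shioda1979_claim_semiDecomposable := by
  refine Shioda1979_claim_semiDecomposable_of_typeII fun m _ β γ hβ0 hγ0 hβ hγ hH ↦ ?_
  obtain ⟨μ, e, E, hE, hX, π, hπ, φ, he, hV⟩ := htypeII m β γ hβ0 hγ0 hβ hγ hH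
  have hC : IsSmoothProjective 1 (fermatHypersurface 1 m) :=
    isSmoothProjective_fermatHypersurface le_rfl NeZero.one_le
  refine ⟨μ, e, E, hE, hX, π, hπ, φ, he, hV.trans (Submodule.span_mono (Set.image_mono ?_))⟩
  rintro K ⟨hKr, hK11⟩
  exact hL (IsSmoothProjective.tensor_holds hC hC) K hKr hK11

/-! ### Ran's / Aoki's road: a ruled join representing `β∗γ`, and `dim V(β∗γ) ≤ 1` -/

/-- **`Shioda1979_claim_semiDecomposable` from a representing ruled join and `dim V ≤ 1`** (Ran §4:
"if `c′` and `c″` are algebraic then so is `c′ ∗ c″`", `H_{χ′} ∗ H_{χ″} = H_{χ′∗χ″}`; Aoki p. 386: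
"if there exists an algebraic cycle `Z` on `Xⁿₘ` such that `ω_α(Z) ≠ 0`, then claim(α) is true").
Granted (I) `hE1` — `dim V(δ) ≤ 1` for admissible characters `δ` of `X²ᵠₘ`, `q > 0` (Ran Prop. 1.7
(i); Shioda §4 "`dim V(α) = 1`"; the hypothesis shared with `Aoki1987_claim_juxtaposition_of_spans`,
`Shioda_claim_paired_of_represents`, `FermatHodgeConjectureAssembly`), and (II) `hjoin` — for all
curve characters `β, γ ∈ 𝔄¹ₘ` with `β∗γ` Hodge, a span `X¹ₘ ⊗ X¹ₘ ←π— E —φ→ X⁴ₘ` (`dim E = 3`,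
`π` flat) and a divisor class `K ∈ N¹H²(X¹ₘ × X¹ₘ)` whose push–pull `φ_*(π^* K)` has non-zero
`(β∗γ)`-component (the ruled surface over a divisor of `V′ × V″` REPRESENTS `β∗γ`), the fact
follows: `φ_*(π^* K) ∈ N²H⁴(X⁴ₘ)` (`complexGysin_map_mem_algebraicClasses_of_flat`), represents ⟹
claim (`FermatCharacter.claim_of_represents`), and permutation invariance of claim.
[cite: Ran1980, §4 p. 139 and Cor. 4.7, Prop. 1.7 (i)] [cite: Aoki1987, p. 386]
[cite: Shioda1979PJA, §4] -/
theorem Shioda1979_claim_semiDecomposable_of_join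
    (hE1 : ∀ (m q : ℕ) [NeZero m] (δ : Fin (2 * q + 2) → ZMod m), 0 < q →
      FermatCharacter.IsAdmissible δ → ∃ u, fermatEigenspace m δ (2 * q) ≤ ℂ ∙ u)
    (hjoin : ∀ (m : ℕ) [NeZero m] (β γ : Fin 3 → ZMod m),
      (∀ i, β i ≠ 0) → (∀ i, γ i ≠ 0) → ∑ i, β i = 0 → ∑ i, γ i = 0 →
      FermatCharacter.IsHodge (Fin.append β γ ∘ finCongr FermatCharacter.two_mul_two_add_two) →
      ∃ (μ : OrientationFamily) (e : ℕ) (E : Motives.SchemeOver ℂ) (hE : IsSmoothProjective e E)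
        (hX : IsSmoothProjective (2 * 2) (fermatHypersurface (2 * 2) m))
        (π : E ⟶ fermatHypersurface 1 m ⊗ fermatHypersurface 1 m) (_ : Flat π.left)
        (φ : E ⟶ fermatHypersurface (2 * 2) m) (he : e = 3),
        ∃ K ∈ algebraicClasses (fermatHypersurface 1 m ⊗ fermatHypersurface 1 m) 1,
          fermatProjector m (Fin.append β γ ∘ finCongr FermatCharacter.two_mul_two_add_two) (2 * 2)
            (complexGysin μ hE hX φ (show 2 * 1 + 2 * (2 * 2) = 2 * 2 + 2 * e by omega)
              (complexBetti.map π (2 * 1) K)) ≠ 0) :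
    Shioda1979_claim_semiDecomposable := by
  intro m _ β γ α hβ0 hγ0 hβ hγ hα hαs
  have hH := FermatCharacter.isHodge_appendCurve_of_univ_val_map_eq hα hαs
  refine FermatCharacter.Claim.of_univ_val_map_eq
    (hαs.trans (FermatCharacter.univ_val_map_appendCurve β γ).symm) ?_
  obtain ⟨μ, e, E, hE, hX, π, hπ, φ, he, K, hK, hne⟩ := hjoin m β γ hβ0 hγ0 hβ hγ hH
  haveI := hπ
  have hC : IsSmoothProjective 1 (fermatHypersurface 1 m) :=
    isSmoothProjective_fermatHypersurface le_rfl NeZero.one_le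
  exact FermatCharacter.claim_of_represents (hE1 m 2 _ two_pos hH.1)
    ⟨_, complexGysin_map_mem_algebraicClasses_of_flat μ hE (IsSmoothProjective.tensor_holds hC hC)
      hX π φ (by omega) hK, hne⟩

/-! ### Arithmetic of the semi-decomposable Hodge characters: `β ∗ γ ∈ 𝔅⁴ₘ` iff `{|tβ|, |tγ|} = {1, 2}` for every unit `t` (Ran Prop. 1.7 (ii)–(iii)) -/

namespace FermatCharacter

variable {m : ℕ}

/-- `m |tα|` through the multiset of values of `α`: `Σᵢ ⟨t αᵢ⟩ = mNormSum ((values of α).map (t · ))`.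
[folklore] -/
theorem normSum_unitMul_eq_mNormSum {r : ℕ} (t : ZMod m) (α : Fin r → ZMod m) :
    normSum (fun i ↦ t * α i) = mNormSum ((univ.val.map α).map (t * ·)) := by
  rw [normSum_eq_mNormSum, Multiset.map_map]
  rfl

/-- **`|t(β ∗ γ)| = |tβ| + |tγ|`** for the literal juxtaposition of two curve characters
(additivity of Shioda's length `y` in `x = x′ + x″`). [cite: Shioda1979PJA, §1 eq. (2) and Definition (iii)] -/
theorem normSum_unitMul_appendCurve (t : ZMod m) (β γ : Fin 3 → ZMod m) :
    normSum (fun i ↦ t * (Fin.append β γ ∘ finCongr two_mul_two_add_two) i) =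
      normSum (fun i ↦ t * β i) + normSum (fun i ↦ t * γ i) := by
  rw [normSum_unitMul_eq_mNormSum, normSum_unitMul_eq_mNormSum, normSum_unitMul_eq_mNormSum,
    univ_val_map_appendCurve, Multiset.map_add, mNormSum_add]

/-- The literal juxtaposition of two curve characters of `𝔄¹ₘ` (non-zero coordinates, sum zero) is
an admissible character of `X⁴ₘ`. [cite: Ran1980, §1 p. 125 (juxtaposition)] -/
theorem isAdmissible_appendCurve {β γ : Fin 3 → ZMod m} (hβ0 : ∀ i, β i ≠ 0) (hγ0 : ∀ i, γ i ≠ 0)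
    (hβ : ∑ i, β i = 0) (hγ : ∑ i, γ i = 0) :
    IsAdmissible (Fin.append β γ ∘ finCongr two_mul_two_add_two) := by
  refine ⟨fun i ↦ ?_, ?_⟩
  · rw [Function.comp_apply]
    refine Fin.addCases (motive := fun j ↦ Fin.append β γ j ≠ 0) (fun j ↦ ?_) (fun j ↦ ?_)
      (finCongr two_mul_two_add_two i)
    · rw [Fin.append_left]; exact hβ0 j
    · rw [Fin.append_right]; exact hγ0 j
  · rw [Finset.sum_eq_multiset_sum, univ_val_map_appendCurve, Multiset.sum_add,
      ← Finset.sum_eq_multiset_sum, ← Finset.sum_eq_multiset_sum, hβ, hγ, add_zero]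

/-- **`β ∗ γ ∈ 𝔅⁴ₘ` iff `|tβ| + |tγ| = 3` for every unit `t`** (`β, γ ∈ 𝔄¹ₘ`): Shioda's length
condition (2) for the semi-decomposable elements `x = x′ + x″` of length `y = 3` — the Hodge
condition on the juxtaposition is a condition on the pair of CM types `t ↦ |tβ|`, `t ↦ |tγ|` of the
two curve characters (Ran Prop. 1.7 (ii)–(iii): `V(tβ) ⊗ V(tγ) ⊂ H²(X¹ₘ × X¹ₘ)` has Hodge type
`(|tβ| + |tγ| − 2, 4 − |tβ| − |tγ|)`, so `⨁ₜ V(tβ) ⊗ V(tγ)` is of type `(1,1)` iff all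
`|tβ| + |tγ| = 3`). [cite: Shioda1979PJA, §1 eq. (2) and Definition (iii)]
[cite: Ran1980, §1 (1.7)–(1.8) and Prop. 1.7 (ii)–(iii)] -/
theorem isHodge_appendCurve_iff {β γ : Fin 3 → ZMod m} (hβ0 : ∀ i, β i ≠ 0) (hγ0 : ∀ i, γ i ≠ 0)
    (hβ : ∑ i, β i = 0) (hγ : ∑ i, γ i = 0) :
    IsHodge (Fin.append β γ ∘ finCongr two_mul_two_add_two) ↔
      ∀ t : (ZMod m)ˣ,
        normSum (fun i ↦ (t : ZMod m) * β i) + normSum (fun i ↦ (t : ZMod m) * γ i) = 3 * m := by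
  refine ⟨fun h t ↦ ?_, fun h ↦ ⟨isAdmissible_appendCurve hβ0 hγ0 hβ hγ, fun t ↦ ?_⟩⟩
  · have h2 := h.2 t
    rw [normSum_unitMul_appendCurve] at h2
    linarith
  · rw [normSum_unitMul_appendCurve, h t]
    ring

/-- **The CM types of `γ` and `−β` coincide** when `β ∗ γ` is a Hodge character: `|tγ| = |t(−β)|`
for every unit `t` (from `|tβ| + |tγ| = 3 = |tβ| + |−tβ|`); i.e. `V(tγ)` and
`V(−tβ) = \overline{V(tβ)}` have the same Hodge type in `H¹(X¹ₘ)` for all `t` — the isogeny-class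
condition on the two factors of the Fermat Jacobian behind the semi-decomposable case.
[cite: Ran1980, §1 (1.7) and Prop. 1.7 (ii)–(iii)] [cite: Shioda1979PJA, §1 Definition (iii)] -/
theorem normSum_unitMul_eq_normSum_unitMul_neg_of_isHodge_appendCurve [NeZero m]
    {β γ : Fin 3 → ZMod m} (hβ0 : ∀ i, β i ≠ 0)
    (h : IsHodge (Fin.append β γ ∘ finCongr two_mul_two_add_two)) (t : (ZMod m)ˣ) :
    normSum (fun i ↦ (t : ZMod m) * γ i) = normSum (fun i ↦ (t : ZMod m) * (-β) i) := by
  have h2 := h.2 t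
  rw [normSum_unitMul_appendCurve] at h2
  have hne : ∀ i, (t : ZMod m) * β i ≠ 0 := fun i ↦ (Units.mul_right_eq_zero t).not.mpr (hβ0 i)
  have hneg := normSum_add_normSum_neg hne
  have e : (-fun i ↦ (t : ZMod m) * β i) = fun i ↦ (t : ZMod m) * (-β) i := by
    funext i
    simp [mul_neg]
  rw [e] at hneg
  linarith

/-- **`|δ| ∈ {1, 2}` for a character `δ ∈ 𝔄¹ₘ` of the Fermat curve** (three non-zero coordinates
summing to zero): `Σᵢ ⟨δᵢ⟩` is a multiple of `m` strictly between `0` and `3m` — the two Hodge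
types `(1,0)` (`|δ| = 1`) and `(0,1)` (`|δ| = 2`) of the eigenlines `V(δ) ⊂ H¹(X¹ₘ)`.
[cite: Ran1980, §1 (1.7) and Prop. 1.7 (ii)] -/
theorem normSum_eq_or_of_curve [NeZero m] {δ : Fin 3 → ZMod m} (hδ0 : ∀ i, δ i ≠ 0)
    (hδ : ∑ i, δ i = 0) : normSum δ = m ∨ normSum δ = 2 * m := by
  have hdvd : m ∣ normSum δ := (ZMod.natCast_eq_zero_iff _ _).mp (by rw [natCast_normSum, hδ])
  have h1 : ∀ i, 1 ≤ (δ i).val := fun i ↦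
    Nat.one_le_iff_ne_zero.mpr ((ZMod.val_ne_zero _).mpr (hδ0 i))
  have h2 : ∀ i, (δ i).val < m := fun i ↦ ZMod.val_lt _
  have hsum : normSum δ = (δ 0).val + (δ 1).val + (δ 2).val := by
    rw [normSum, Fin.sum_univ_three]
  obtain ⟨k, hk⟩ := hdvd
  have hk0 : 0 < k := by
    rcases Nat.eq_zero_or_pos k with rfl | hk'
    · have := h1 0
      rw [hsum] at hk
      omega
    · exact hk'
  have hk3 : k < 3 := by
    refine Nat.lt_of_mul_lt_mul_left (a := m) ?_
    have := h2 0
    have := h2 1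
    have := h2 2
    rw [← hk, hsum]
    omega
  interval_cases k <;> omega

/-- **Ran's form of the Hodge condition on `β ∗ γ`**: for `β, γ ∈ 𝔄¹ₘ`, `β ∗ γ ∈ 𝔅⁴ₘ` iff for
every unit `t` one of `tβ`, `tγ` has `|·| = 1` and the other `|·| = 2` (`V(tβ) ⊗ V(tγ)` of type
`(1,0) ⊗ (0,1)` or `(0,1) ⊗ (1,0)`, i.e. `(1,1)`, for every `t`: the sub-Hodge structure
`⨁ₜ V(tβ) ⊗ V(tγ)` of `H²(X¹ₘ × X¹ₘ)`, which is defined over `ℚ`, is of type `(1,1)` — the input of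
Lefschetz's theorem on `(1,1)`-classes in the semi-decomposable case).
[cite: Ran1980, §1 Prop. 1.7 (ii)–(iii)] [cite: Shioda1979PJA, §1 Definition (iii) and §4] -/
theorem isHodge_appendCurve_iff_normSum_eq [NeZero m] {β γ : Fin 3 → ZMod m} (hβ0 : ∀ i, β i ≠ 0)
    (hγ0 : ∀ i, γ i ≠ 0) (hβ : ∑ i, β i = 0) (hγ : ∑ i, γ i = 0) :
    IsHodge (Fin.append β γ ∘ finCongr two_mul_two_add_two) ↔
      ∀ t : (ZMod m)ˣ,
        (normSum (fun i ↦ (t : ZMod m) * β i) = m ∧ normSum (fun i ↦ (t : ZMod m) * γ i) = 2 * m) ∨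
          (normSum (fun i ↦ (t : ZMod m) * β i) = 2 * m ∧ normSum (fun i ↦ (t : ZMod m) * γ i) = m) := by
  rw [isHodge_appendCurve_iff hβ0 hγ0 hβ hγ]
  refine forall_congr' fun t ↦ ?_
  have hb := normSum_eq_or_of_curve (δ := fun i ↦ (t : ZMod m) * β i)
    (fun i ↦ (Units.mul_right_eq_zero t).not.mpr (hβ0 i)) (by rw [← Finset.mul_sum, hβ, mul_zero])
  have hc := normSum_eq_or_of_curve (δ := fun i ↦ (t : ZMod m) * γ i)
    (fun i ↦ (Units.mul_right_eq_zero t).not.mpr (hγ0 i)) (by rw [← Finset.mul_sum, hγ, mul_zero])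
  have hm : 0 < m := Nat.pos_of_ne_zero (NeZero.ne m)
  omega

end FermatCharacter

end Literature.AlgebraicGeometry.HodgeTheory

end
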